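import Mathlib
import Literature.Probability.RandomPlanarGeometry.ConformalRectangleProofs
import Literature.Probability.RandomPlanarGeometry.ChordalCurveFamily
import Literature.Probability.RandomPlanarGeometry.JordanBoundaryChart
import HarnessLib

/-!
# Modulus-preserving homeomorphisms: the (anti)conformal map with the same boundary values

Topic `Literature/Probability/RandomPlanarGeometry` (input of the rigidity step of crux
stmt-CriticalPhenomena-0698, `Summits/CriticalPhenomena/CardyFormulaZ2`).

A homeomorphism `T` of the plane preserving the conformal modulus (Cardy's cross-ratio) of every
conformal rectangle agrees, along the boundary of every Jordan domain `Ω`, with a conformal or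
anti-conformal equivalence `G : Ω → T Ω` (`exists_conformalMap_of_modulusPreserving`). This is the
first half of the classical fact that homeomorphisms preserving the moduli of all quadrilaterals
(1-quasiconformal maps in the geometric sense) are conformal or anti-conformal (Lehto–Virtanen
(1973), Ch. I §5).

Construction. Boundary charts `(φ, g)` of `Ω` and `(φ', g')` of `Ω.map T` based at the same
parameter `t₁` (`JordanDomain.exists_boundaryChart`); modulus preservation on the rectangles
`(Ω; t₀ < t₁' < t₂ < t₃ < t₁)` makes `g, g'` have equal cross-ratios on increasing 4-tuples of
`[0, t₁)`, hence `g' = A g + B` (`affine_of_crossRatio_eq`); then `G = φ' ∘ L ∘ φ⁻¹` with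
`L z = A z + B` (`A > 0`, conformal) or `L z = A z̄ + B` (`A < 0`, anti-conformal), and `G → T p`
at every boundary point `p = Ω.boundary t`, `t ∈ [0, t₁)`.

## References

* O. Lehto, K. I. Virtanen, *Quasiconformal Mappings in the Plane*, Springer (1973), Ch. I §5.
-/

noncomputable section

open Set Filter Topology Complex Metric
open UpperHalfPlane (upperHalfPlaneSet)
open scoped ComplexConjugate

namespace Literature.Probability.RandomPlanarGeometry

/-! ### Composite charts -/

/-- **Composite of two boundary charts through a self-map of `ℍ`.** Given charts `φ : ℍ → Ω`,
`φ' : ℍ → T Ω` with boundary correspondences `g, g'` on the parameters `[0, t₁)`, and a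
continuous bijection `L` of `ℍ` (inverse `Linv`) with `L (g t) = g' t`, the composite
`G = φ' ∘ L ∘ φ⁻¹ : Ω → T Ω` (inverse `φ ∘ Linv ∘ φ'⁻¹`) tends to `T p` at every boundary point
`p = Ω.boundary t`, `t ∈ [0, t₁)`, and its inverse tends to `p` at `T p`. [folklore] -/
theorem compChart_props {Ω : JordanDomain} {T : ℂ ≃ₜ ℂ} {t₁ : ℝ}
    (φ : ConformalEquiv upperHalfPlaneSet Ω.carrier)
    (φ' : ConformalEquiv upperHalfPlaneSet (Ω.map T).carrier) {g g' : ℝ → ℝ}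
    (h1 : ∀ t ∈ Ico 0 t₁, φ.HasBoundaryValue (g t) (Ω.boundary t))
    (h2 : ∀ t ∈ Ico 0 t₁, Tendsto φ.symm (𝓝[Ω.carrier] (Ω.boundary t)) (𝓝 (g t)))
    (h1' : ∀ t ∈ Ico 0 t₁, φ'.HasBoundaryValue (g' t) (T (Ω.boundary t)))
    (h2' : ∀ t ∈ Ico 0 t₁, Tendsto φ'.symm (𝓝[T '' Ω.carrier] (T (Ω.boundary t))) (𝓝 (g' t)))
    {L Linv : ℂ → ℂ} (hLc : Continuous L) (hLic : Continuous Linv)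
    (hLm : MapsTo L upperHalfPlaneSet upperHalfPlaneSet)
    (hLim : MapsTo Linv upperHalfPlaneSet upperHalfPlaneSet)
    (hLL : ∀ u ∈ upperHalfPlaneSet, Linv (L u) = u) (hLL' : ∀ v ∈ upperHalfPlaneSet, L (Linv v) = v)
    (hLg : ∀ t ∈ Ico 0 t₁, L (g t) = g' t) (hLg' : ∀ t ∈ Ico 0 t₁, Linv (g' t) = g t) :
    MapsTo (fun z ↦ φ' (L (φ.symm z))) Ω.carrier (T '' Ω.carrier) ∧
    MapsTo (fun w ↦ φ (Linv (φ'.symm w))) (T '' Ω.carrier) Ω.carrier ∧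
    (∀ z ∈ Ω.carrier, φ (Linv (φ'.symm (φ' (L (φ.symm z))))) = z) ∧
    (∀ w ∈ T '' Ω.carrier, φ' (L (φ.symm (φ (Linv (φ'.symm w))))) = w) ∧
    (∀ t ∈ Ico 0 t₁, Tendsto (fun z ↦ φ' (L (φ.symm z))) (𝓝[Ω.carrier] (Ω.boundary t))
      (𝓝 (T (Ω.boundary t)))) ∧
    (∀ t ∈ Ico 0 t₁, Tendsto (fun w ↦ φ (Linv (φ'.symm w))) (𝓝[T '' Ω.carrier] (T (Ω.boundary t)))
      (𝓝 (Ω.boundary t))) := by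
  have hΩ' : (Ω.map T).carrier = T '' Ω.carrier := rfl
  refine ⟨fun z hz ↦ ?_, fun w hw ↦ ?_, fun z hz ↦ ?_, fun w hw ↦ ?_, fun t ht ↦ ?_, fun t ht ↦ ?_⟩
  · exact φ'.mapsTo (hLm (φ.symm_mapsTo hz))
  · exact φ.mapsTo (hLim (φ'.symm_mapsTo (hΩ' ▸ hw)))
  · rw [φ'.symm_apply_apply (hLm (φ.symm_mapsTo hz)), hLL _ (φ.symm_mapsTo hz),
      φ.apply_symm_apply hz]
  · rw [φ.symm_apply_apply (hLim (φ'.symm_mapsTo (hΩ' ▸ hw))), hLL' _ (φ'.symm_mapsTo (hΩ' ▸ hw)),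
      φ'.apply_symm_apply (hΩ' ▸ hw)]
  · have hs : Tendsto φ.symm (𝓝[Ω.carrier] (Ω.boundary t)) (𝓝[upperHalfPlaneSet] (g t)) :=
      tendsto_nhdsWithin_iff.2 ⟨h2 t ht, eventually_nhdsWithin_of_forall fun z hz ↦ φ.symm_mapsTo hz⟩
    have hL : Tendsto L (𝓝[upperHalfPlaneSet] (g t : ℂ)) (𝓝[upperHalfPlaneSet] (g' t : ℂ)) := by
      rw [← hLg t ht]
      exact hLc.continuousWithinAt.tendsto_nhdsWithin hLm
    exact (h1' t ht).comp (hL.comp hs)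
  · have hs : Tendsto φ'.symm (𝓝[T '' Ω.carrier] (T (Ω.boundary t)))
        (𝓝[upperHalfPlaneSet] (g' t)) :=
      tendsto_nhdsWithin_iff.2 ⟨h2' t ht,
        eventually_nhdsWithin_of_forall fun w hw ↦ φ'.symm_mapsTo (hΩ' ▸ hw)⟩
    have hL : Tendsto Linv (𝓝[upperHalfPlaneSet] (g' t : ℂ)) (𝓝[upperHalfPlaneSet] (g t : ℂ)) := by
      rw [← hLg' t ht]
      exact hLic.continuousWithinAt.tendsto_nhdsWithin hLim
    exact (h1 t ht).comp (hL.comp hs)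

/-- `conj ∘ f ∘ conj` is holomorphic on the reflected set where `f` is holomorphic on an open set. [folklore] -/
theorem differentiableOn_conj_conj {f : ℂ → ℂ} {U : Set ℂ} (hU : IsOpen U)
    (hf : DifferentiableOn ℂ f U) :
    DifferentiableOn ℂ (fun z ↦ conj (f (conj z))) {z | conj z ∈ U} := by
  intro z hz
  have h : DifferentiableAt ℂ f (conj z) := hf.differentiableAt (hU.mem_nhds hz)
  have := (differentiableAt_conj_conj_iff (f := f) (x := z)).2 h
  exact this.differentiableWithinAt

/-! ### The (anti)conformal map with boundary values `T` -/

/-- **(R2) Modulus-preserving homeomorphisms are conformal or anti-conformal on the boundary of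
every Jordan domain.** Let `T` be a homeomorphism of the plane preserving Cardy's cross-ratio of
every conformal rectangle (computed from any conformal charts with the right boundary values),
`Ω` a Jordan domain and `t₁ ∈ (0, 1)`. Then there are maps `G : Ω → T Ω`, `Ginv : T Ω → Ω`,
inverse to each other, each holomorphic or anti-holomorphic, such that `G z → T p` as `z → p`
inside `Ω` and `Ginv w → p` as `w → T p` inside `T Ω`, for every boundary point
`p = Ω.boundary t` with `t ∈ [0, t₁)`. [cite: LehtoVirtanen1973, Ch. I §5] -/
theorem exists_conformalMap_of_modulusPreserving (T : ℂ ≃ₜ ℂ)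
    (hT : ∀ (R : ConformalRectangle) (φ : ConformalEquiv upperHalfPlaneSet R.carrier)
      (x : Fin 4 → ℝ) (φ' : ConformalEquiv upperHalfPlaneSet (R.map T).carrier) (x' : Fin 4 → ℝ),
      (∀ i, φ.HasBoundaryValue (x i) (R.pt i)) →
      (∀ i, φ'.HasBoundaryValue (x' i) ((R.map T).pt i)) → crossRatio x = crossRatio x')
    (Ω : JordanDomain) {t₁ : ℝ} (ht₁ : t₁ ∈ Ioo (0 : ℝ) 1) :
    ∃ G Ginv : ℂ → ℂ,
      (DifferentiableOn ℂ G Ω.carrier ∨ DifferentiableOn ℂ (fun z ↦ conj (G z)) Ω.carrier) ∧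
      (DifferentiableOn ℂ Ginv (T '' Ω.carrier) ∨
        DifferentiableOn ℂ (fun w ↦ conj (Ginv w)) (T '' Ω.carrier)) ∧
      MapsTo G Ω.carrier (T '' Ω.carrier) ∧ MapsTo Ginv (T '' Ω.carrier) Ω.carrier ∧
      (∀ z ∈ Ω.carrier, Ginv (G z) = z) ∧ (∀ w ∈ T '' Ω.carrier, G (Ginv w) = w) ∧
      (∀ t ∈ Ico 0 t₁, Tendsto G (𝓝[Ω.carrier] (Ω.boundary t)) (𝓝 (T (Ω.boundary t)))) ∧
      (∀ t ∈ Ico 0 t₁, Tendsto Ginv (𝓝[T '' Ω.carrier] (T (Ω.boundary t))) (𝓝 (Ω.boundary t))) := by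
  obtain ⟨φ, g, h1, h2, h3, h4, -, -⟩ := Ω.exists_boundaryChart t₁
  obtain ⟨φ', g', h1', h2', h3', h4', -, -⟩ := (Ω.map T).exists_boundaryChart t₁
  have hΩ'c : (Ω.map T).carrier = T '' Ω.carrier := rfl
  have hΩ'b : ∀ t, (Ω.map T).boundary t = T (Ω.boundary t) := fun t ↦ rfl
  have hne : ∀ t ∈ Ico 0 t₁, Ω.boundary t ≠ Ω.boundary t₁ := by
    intro t ht h
    have := Ω.injOn_boundary ⟨ht.1, ht.2.trans ht₁.2⟩ ⟨ht₁.1.le, ht₁.2⟩ h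
    exact ht.2.ne this
  have hne' : ∀ t ∈ Ico 0 t₁, (Ω.map T).boundary t ≠ (Ω.map T).boundary t₁ :=
    fun t ht h ↦ hne t ht (T.injective h)
  have hsub : Ico 0 t₁ ⊆ {t | Ω.boundary t ≠ Ω.boundary t₁} := fun t ht ↦ hne t ht
  have hsub' : Ico 0 t₁ ⊆ {t | (Ω.map T).boundary t ≠ (Ω.map T).boundary t₁} := fun t ht ↦ hne' t ht
  -- the cross-ratio identity from modulus preservation
  have hcr : ∀ t : Fin 4 → ℝ, StrictMono t → (∀ i, t i ∈ Ico 0 t₁) →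
      crossRatio (fun i ↦ g (t i)) = crossRatio (fun i ↦ g' (t i)) := by
    intro t ht htm
    let R : ConformalRectangle :=
      { toJordanDomain := Ω, mark := t, strictMono_mark := ht,
        mark_mem := fun i ↦ ⟨(htm i).1, (htm i).2.trans ht₁.2⟩ }
    exact hT R φ (fun i ↦ g (t i)) φ' (fun i ↦ g' (t i)) (fun i ↦ h1 (t i) (hne _ (htm i)))
      (fun i ↦ h1' (t i) (hne' _ (htm i)))
  have hinj : InjOn g (Ico 0 t₁) := fun s hs t ht hst ↦
    Ω.injOn_boundary ⟨hs.1, hs.2.trans ht₁.2⟩ ⟨ht.1, ht.2.trans ht₁.2⟩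
      (h3 s t (hne s hs) (hne t ht) hst)
  have hinj' : InjOn g' (Ico 0 t₁) := fun s hs t ht hst ↦
    Ω.injOn_boundary ⟨hs.1, hs.2.trans ht₁.2⟩ ⟨ht.1, ht.2.trans ht₁.2⟩
      (T.injective (h3' s t (hne' s hs) (hne' t ht) hst))
  obtain ⟨A, B, hA, hAB⟩ := affine_of_crossRatio_eq ht₁.1 hcr hinj hinj'
    (h4.mono_left (nhdsWithin_mono _ hsub)) (h4'.mono_left (nhdsWithin_mono _ hsub'))
  -- the data fed to `compChart_props`
  have k1 : ∀ t ∈ Ico 0 t₁, φ.HasBoundaryValue (g t) (Ω.boundary t) := fun t ht ↦ h1 t (hne t ht)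
  have k2 : ∀ t ∈ Ico 0 t₁, Tendsto φ.symm (𝓝[Ω.carrier] (Ω.boundary t)) (𝓝 (g t)) :=
    fun t ht ↦ h2 t (hne t ht)
  have k1' : ∀ t ∈ Ico 0 t₁, φ'.HasBoundaryValue (g' t) (T (Ω.boundary t)) :=
    fun t ht ↦ h1' t (hne' t ht)
  have k2' : ∀ t ∈ Ico 0 t₁, Tendsto φ'.symm (𝓝[T '' Ω.carrier] (T (Ω.boundary t))) (𝓝 (g' t)) :=
    fun t ht ↦ h2' t (hne' t ht)
  have hAB' : ∀ t ∈ Ico 0 t₁, (A : ℂ) * (g t : ℂ) + B = g' t := fun t ht ↦ by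
    rw [hAB t ht]; push_cast; ring
  rcases lt_or_gt_of_ne hA with hAneg | hApos
  · -- `A < 0`: the anti-conformal case, `L u = A ū + B`
    set L : ℂ → ℂ := fun u ↦ (A : ℂ) * conj u + B with hL
    set Linv : ℂ → ℂ := fun v ↦ conj ((v - B) / A) with hLinv
    have hA0 : (A : ℂ) ≠ 0 := ofReal_ne_zero.2 hA
    have hLc : Continuous L := by rw [hL]; fun_prop
    have hLic : Continuous Linv := by rw [hLinv]; fun_prop
    have hLm : MapsTo L upperHalfPlaneSet upperHalfPlaneSet := by
      intro u hu
      change 0 < ((A : ℂ) * conj u + B).im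
      have hu' : 0 < u.im := hu
      simp only [add_im, mul_im, ofReal_re, conj_im, ofReal_im, conj_re, zero_mul, add_zero]
      nlinarith
    have hLim : MapsTo Linv upperHalfPlaneSet upperHalfPlaneSet := by
      intro v hv
      change 0 < (conj ((v - B) / A)).im
      have hv' : 0 < v.im := hv
      rw [conj_im, div_ofReal_im, sub_im, ofReal_im, sub_zero]
      have : v.im / A < 0 := div_neg_of_pos_of_neg hv' hAneg
      linarith
    have hLL : ∀ u ∈ upperHalfPlaneSet, Linv (L u) = u := fun u _ ↦ by
      simp only [hL, hLinv]
      rw [add_sub_cancel_right, mul_div_cancel_left₀ _ hA0, Complex.conj_conj]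
    have hLL' : ∀ v ∈ upperHalfPlaneSet, L (Linv v) = v := fun v _ ↦ by
      simp only [hL, hLinv]
      rw [Complex.conj_conj, mul_div_cancel₀ _ hA0, sub_add_cancel]
    have hLg : ∀ t ∈ Ico 0 t₁, L (g t) = g' t := fun t ht ↦ by
      simp only [hL]; rw [conj_ofReal, hAB' t ht]
    have hLg' : ∀ t ∈ Ico 0 t₁, Linv (g' t) = g t := fun t ht ↦ by
      simp only [hLinv]
      rw [← hAB' t ht, add_sub_cancel_right, mul_div_cancel_left₀ _ hA0, conj_ofReal]
    obtain ⟨m1, m2, m3, m4, m5, m6⟩ :=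
      compChart_props φ φ' k1 k2 k1' k2' hLc hLic hLm hLim hLL hLL' hLg hLg'
    refine ⟨fun z ↦ φ' (L (φ.symm z)), fun w ↦ φ (Linv (φ'.symm w)), Or.inr ?_, Or.inr ?_,
      m1, m2, m3, m4, m5, m6⟩
    · -- `conj ∘ G = (conj ∘ φ' ∘ conj) ∘ (A · + B) ∘ φ⁻¹`
      have hP : DifferentiableOn ℂ (fun v ↦ conj (φ' (conj v))) {v | conj v ∈ upperHalfPlaneSet} :=
        differentiableOn_conj_conj UpperHalfPlane.isOpen_upperHalfPlaneSet φ'.differentiableOn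
      have hN : DifferentiableOn ℂ (fun z ↦ (A : ℂ) * φ.symm z + B) Ω.carrier :=
        ((differentiableOn_const _).mul φ.symm.differentiableOn).add (differentiableOn_const _)
      have hNm : MapsTo (fun z ↦ (A : ℂ) * φ.symm z + B) Ω.carrier {v | conj v ∈ upperHalfPlaneSet} := by
        intro z hz
        have hu : 0 < (φ.symm z).im := φ.symm_mapsTo hz
        change 0 < (conj ((A : ℂ) * φ.symm z + B)).im
        rw [conj_im, add_im, mul_im, ofReal_re, ofReal_im, zero_mul, add_zero, ofReal_im, add_zero]
        nlinarith
      refine (hP.comp hN hNm).congr fun z _ ↦ ?_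
      simp only [hL, Function.comp_apply, map_add, map_mul, conj_ofReal]
    · -- `conj ∘ Ginv = (conj ∘ φ ∘ conj) ∘ ((· - B)/A) ∘ φ'⁻¹`
      have hP : DifferentiableOn ℂ (fun v ↦ conj (φ (conj v))) {v | conj v ∈ upperHalfPlaneSet} :=
        differentiableOn_conj_conj UpperHalfPlane.isOpen_upperHalfPlaneSet φ.differentiableOn
      have hN : DifferentiableOn ℂ (fun w ↦ (φ'.symm w - B) / A) (T '' Ω.carrier) :=
        ((φ'.symm.differentiableOn : DifferentiableOn ℂ _ (T '' Ω.carrier)).sub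
          (differentiableOn_const _)).div_const _
      have hNm : MapsTo (fun w ↦ (φ'.symm w - B) / A) (T '' Ω.carrier)
          {v | conj v ∈ upperHalfPlaneSet} := by
        intro w hw
        have hv : 0 < (φ'.symm w).im := φ'.symm_mapsTo (hΩ'c ▸ hw)
        change 0 < (conj ((φ'.symm w - ↑B) / ↑A)).im
        rw [conj_im, div_ofReal_im, sub_im, ofReal_im, sub_zero]
        have : (φ'.symm w).im / A < 0 := div_neg_of_pos_of_neg hv hAneg
        linarith
      refine (hP.comp hN hNm).congr fun w _ ↦ ?_
      simp only [hLinv, Function.comp_apply]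
  · -- `A > 0`: the conformal case, `L u = A u + B`
    set M : ConformalEquiv upperHalfPlaneSet upperHalfPlaneSet :=
      (ConformalEquiv.smulUpperHalfPlane A hApos).trans (addRealUpperHalfPlane B) with hM
    have hMa : ∀ u, M u = (A : ℂ) * u + B := fun u ↦ by
      rw [hM, ConformalEquiv.trans_apply, ConformalEquiv.smulUpperHalfPlane_apply,
        addRealUpperHalfPlane_apply, real_smul]
    have hMs : ∀ v, M.symm v = (A : ℂ)⁻¹ * (v - B) := fun v ↦ by
      change (ConformalEquiv.smulUpperHalfPlane A hApos).symm ((addRealUpperHalfPlane B).symm v) = _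
      rw [ConformalEquiv.smulUpperHalfPlane_symm_apply, real_smul, ofReal_inv]
      rfl
    have hA0 : (A : ℂ) ≠ 0 := ofReal_ne_zero.2 hA
    have hLg : ∀ t ∈ Ico 0 t₁, M (g t) = g' t := fun t ht ↦ by rw [hMa, hAB' t ht]
    have hLg' : ∀ t ∈ Ico 0 t₁, M.symm (g' t) = g t := fun t ht ↦ by
      rw [hMs, ← hAB' t ht, add_sub_cancel_right, ← mul_assoc, inv_mul_cancel₀ hA0, one_mul]
    obtain ⟨m1, m2, m3, m4, m5, m6⟩ :=
      compChart_props φ φ' k1 k2 k1' k2' (L := M) (Linv := M.symm)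
        (by simp only [funext hMa]; fun_prop) (by simp only [funext hMs]; fun_prop)
        M.mapsTo M.symm_mapsTo (fun u hu ↦ M.symm_apply_apply hu) (fun v hv ↦ M.apply_symm_apply hv)
        hLg hLg'
    refine ⟨fun z ↦ φ' (M (φ.symm z)), fun w ↦ φ (M.symm (φ'.symm w)), Or.inl ?_, Or.inl ?_,
      m1, m2, m3, m4, m5, m6⟩
    · exact (φ.symm.trans (M.trans φ')).differentiableOn
    · exact ((φ.symm.trans (M.trans φ')).symm.differentiableOn : DifferentiableOn ℂ _ (T '' Ω.carrier))

end Literature.Probability.RandomPlanarGeometry
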